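import Summits.CriticalPhenomena.SAWScalingLimit.Theses.SAWRingGibbsDescent

/-!
# Line `common-pin-triangle` — typed decomposition of the crux `DomainContinuity`
(stmt-CriticalPhenomena-11309, route SAWRingGibbsDescent; crux-strategist BC2 redirect)

`DomainContinuity` (joint continuity of the critical SAW law in (wall, pins), uniformly in the
mesh) is cut along the Moore–Osgood seam "joint continuity ⇐ continuity in each variable at a
common anchor + a uniform modulus":

* `PinLocality` (crux, EndpointLocality): along a wall sequence `Ws n → W` (simple limit wall) the
  critical SAW law of `Ws n` is insensitive to WHICH lattice pins within `ρ` of the marks are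
  used (pins in one component), uniformly in `n ≥ N` and `δ < δ₀` (a modulus `ε ↦ ρ`); the
  constant sequence gives the same for `W`.
* `CommonPinWallContinuity` (crux, NoHugging): for the SAME lattice pins, joined in both graphs and
  `s`-deep in both domains, the laws in `Ws n` and in `W` merge, uniformly — pure wall sensitivity,
  no pin change (by the exact lattice restriction identity this is two collar-exit estimates).
* `CommonPinsExist` (support, lattice geometry of Jordan domains): whenever `Ws n` and `W` both
  have a joined pin pair near the marks, they have a COMMON one, `s`-deep in both domains, joined in
  both graphs and to the given pairs (`s = s(ρ)` uniform in `n`: an inradius ball of `W ∩ B(pt, ρ/2)`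
  lies in every `Ws n`, `n ≥ N`, by the tracking lemma, and in both bulks).

`DomainContinuity_of` is the ε/3-assembly: anchor at a common pin pair `(c, d)` supplied by
`CommonPinsExist`, move the given pins of `Ws n` to `(c, d)` by `PinLocality`, cross from `Ws n`
to `W` at `(c, d)` by `CommonPinWallContinuity`, and move `(c, d)` to `(a δ, b δ)` inside `W` by
`PinLocality` for the constant wall sequence; the radii are threaded so that every application
is licensed (`σ ≤ ρ' ∧ σ ≤ ρ_P`, `ρ ≤ ρ_P ∧ ρ ≤ ρ_Q`), and the mesh threshold also absorbs the
eventual `σ`-closeness of all pins (extracted from `𝓝[>] 0`).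
-/

noncomputable section

namespace Summit.CriticalPhenomena.SAWScalingLimit.Cruxes.DomainContinuity.CommonPinTriangle

open Filter Topology
open Summit.CriticalPhenomena.SAWScalingLimit.Theses.SAWRingGibbsDescent (DomainContinuity)

/-- Piece 1 (crux · EndpointLocality, uniform form). Along a wall sequence with simple limit wall,
the critical SAW law of `Ws n` at mesh `δ` does not depend, up to `ε` in every bounded continuous
observable, on which joined lattice pins within `ρ = ρ(f, ε)` of the marks are used — uniformly in
`n ≥ N`, `δ < δ₀`. [folklore] -/
def PinLocality : Prop :=
  ∀ (D : Literature.Probability.RandomPlanarGeometry.DobrushinDomain), (let IsWall : Literature.Probability.RandomPlanarGeometry.CurveClass ℂ → Literature.Probability.RandomPlanarGeometry.DobrushinDomain → Prop := fun η W => W.carrier ⊆ D.carrier ∧ W.pt 0 = D.pt 0 ∧ W.pt 1 = D.pt 1 ∧ frontier W.carrier = η.range ∪ D.arc 1; ∀ (ηs : ℕ → Literature.Probability.RandomPlanarGeometry.CurveClass ℂ) (η : Literature.Probability.RandomPlanarGeometry.CurveClass ℂ) (Ws : ℕ → Literature.Probability.RandomPlanarGeometry.DobrushinDomain) (W : Literature.Probability.RandomPlanarGeometry.DobrushinDomain),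 (∀ n, IsWall (ηs n) (Ws n)) → IsWall η W → η ∈ Literature.Probability.RandomPlanarGeometry.CurveClass.simple → Filter.Tendsto ηs Filter.atTop (nhds η) → ∀ f : BoundedContinuousFunction (Literature.Probability.RandomPlanarGeometry.CurveClass ℂ) ℝ, ∀ ε > (0 : ℝ), ∃ ρ : ℝ, 0 < ρ ∧ ∃ N : ℕ, ∃ δ₀ : ℝ, 0 < δ₀ ∧ ∀ n ≥ N, ∀ δ ∈ Set.Ioo (0 : ℝ) δ₀, ∀ x y x' y' : Literature.Probability.LatticeModels.Site 2, dist (Literature.Probability.LatticeModels.meshPoint δ x) (D.pt 0) < ρ → dist (Literature.Probability.LatticeModels.meshPoint δ y) (D.pt 1) < ρ → dist (Literature.Probability.LatticeModels.meshPoint δ x') (D.pt 0) < ρ → dist (Literature.Probability.LatticeModels.meshPoint δ y') (D.pt 1) < ρ → (Literature.Probability.LatticeModels.discreteDomainGraph (Ws n).carrier δ).Reachable x y → (Literature.Probability.LatticeModels.discreteDomainGraph (Ws n).carrier δ).Reachable x' y' → (Literature.Probability.LatticeModels.discreteDomainGraph (Ws n).carrier δ).Reachable x x' → |(∫ γ,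 f γ.curve ∂(Literature.Probability.RandomPlanarGeometry.SAW.law (Ws n).carrier δ x y)) - ∫ γ, f γ.curve ∂(Literature.Probability.RandomPlanarGeometry.SAW.law (Ws n).carrier δ x' y')| < ε)

/-- Piece 2 (crux · NoHugging at common deep pins). For the SAME lattice pins, joined in both graphs,
within `ρ = ρ(f, ε)` of the marks and `s`-deep in both domains (any `s > 0`; `N, δ₀` may depend on
it), the critical SAW laws of `Ws n` and of `W` at mesh `δ` are `ε`-close in every bounded continuous
observable, uniformly in `n ≥ N`, `δ < δ₀`. [folklore] -/
def CommonPinWallContinuity : Prop :=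
  ∀ (D : Literature.Probability.RandomPlanarGeometry.DobrushinDomain), (let IsWall : Literature.Probability.RandomPlanarGeometry.CurveClass ℂ → Literature.Probability.RandomPlanarGeometry.DobrushinDomain → Prop := fun η W => W.carrier ⊆ D.carrier ∧ W.pt 0 = D.pt 0 ∧ W.pt 1 = D.pt 1 ∧ frontier W.carrier = η.range ∪ D.arc 1; ∀ (ηs : ℕ → Literature.Probability.RandomPlanarGeometry.CurveClass ℂ) (η : Literature.Probability.RandomPlanarGeometry.CurveClass ℂ) (Ws : ℕ → Literature.Probability.RandomPlanarGeometry.DobrushinDomain) (W : Literature.Probability.RandomPlanarGeometry.DobrushinDomain), (∀ n, IsWall (ηs n) (Ws n)) → IsWall η W → η ∈ Literature.Probability.RandomPlanarGeometry.CurveClass.simple → Filter.Tendsto ηs Filter.atTop (nhds η) → ∀ f : BoundedContinuousFunction (Literature.Probability.RandomPlanarGeometry.CurveClass ℂ) ℝ, ∀ ε > (0 : ℝ), ∃ ρ : ℝ, 0 < ρ ∧ ∀ s > (0 : ℝ), ∃ N : ℕ, ∃ δ₀ : ℝ, 0 < δ₀ ∧ ∀ n ≥ N, ∀ δ ∈ Set.Ioo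 (0 : ℝ) δ₀, ∀ x y : Literature.Probability.LatticeModels.Site 2, dist (Literature.Probability.LatticeModels.meshPoint δ x) (D.pt 0) < ρ → dist (Literature.Probability.LatticeModels.meshPoint δ y) (D.pt 1) < ρ → Metric.ball (Literature.Probability.LatticeModels.meshPoint δ x) s ⊆ (Ws n).carrier ∩ W.carrier → Metric.ball (Literature.Probability.LatticeModels.meshPoint δ y) s ⊆ (Ws n).carrier ∩ W.carrier → (Literature.Probability.LatticeModels.discreteDomainGraph (Ws n).carrier δ).Reachable x y → (Literature.Probability.LatticeModels.discreteDomainGraph W.carrier δ).Reachable x y → |(∫ γ, f γ.curve ∂(Literature.Probability.RandomPlanarGeometry.SAW.law (Ws n).carrier δ x y)) - ∫ γ, f γ.curve ∂(Literature.Probability.RandomPlanarGeometry.SAW.law W.carrier δ x y)| < ε)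

/-- Piece 3 (support · lattice geometry, no SAW). For every radius `ρ` there are a trigger radius
`ρ'` and a depth `s` such that, eventually in `n` and `δ`, if `Ws n` has a joined pin pair within `ρ'`
of the marks and `W` has one, then some pin pair within `ρ` of the marks, `s`-deep in both domains,
is joined in BOTH graphs and to the two given pairs. [folklore] -/
def CommonPinsExist : Prop :=
  ∀ (D : Literature.Probability.RandomPlanarGeometry.DobrushinDomain), (let IsWall : Literature.Probability.RandomPlanarGeometry.CurveClass ℂ → Literature.Probability.RandomPlanarGeometry.DobrushinDomain → Prop := fun η W => W.carrier ⊆ D.carrier ∧ W.pt 0 = D.pt 0 ∧ W.pt 1 = D.pt 1 ∧ frontier W.carrier = η.range ∪ D.arc 1; ∀ (ηs : ℕ → Literature.Probability.RandomPlanarGeometry.CurveClass ℂ) (η : Literature.Probability.RandomPlanarGeometry.CurveClass ℂ) (Ws : ℕ → Literature.Probability.RandomPlanarGeometry.DobrushinDomain) (W : Literature.Probability.RandomPlanarGeometry.DobrushinDomain), (∀ n, IsWall (ηs n) (Ws n)) → IsWall η W → η ∈ Literature.Probability.RandomPlanarGeometry.CurveClass.simple → Filter.Tendsto ηs Filter.atTop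 (nhds η) → ∀ ρ > (0 : ℝ), ∃ ρ' : ℝ, 0 < ρ' ∧ ∃ s : ℝ, 0 < s ∧ ∃ N : ℕ, ∃ δ₀ : ℝ, 0 < δ₀ ∧ ∀ n ≥ N, ∀ δ ∈ Set.Ioo (0 : ℝ) δ₀, ∀ x y x' y' : Literature.Probability.LatticeModels.Site 2, dist (Literature.Probability.LatticeModels.meshPoint δ x) (D.pt 0) < ρ' → dist (Literature.Probability.LatticeModels.meshPoint δ y) (D.pt 1) < ρ' → dist (Literature.Probability.LatticeModels.meshPoint δ x') (D.pt 0) < ρ' → dist (Literature.Probability.LatticeModels.meshPoint δ y') (D.pt 1) < ρ' → (Literature.Probability.LatticeModels.discreteDomainGraph (Ws n).carrier δ).Reachable x y → (Literature.Probability.LatticeModels.discreteDomainGraph W.carrier δ).Reachable x' y' → ∃ c d : Literature.Probability.LatticeModels.Site 2, dist (Literature.Probability.LatticeModels.meshPoint δ c) (D.pt 0) < ρ ∧ dist (Literature.Probability.LatticeModels.meshPoint δ d) (D.pt 1) < ρ ∧ Metric.ball (Literature.Probability.LatticeModels.meshPoint δ c) s ⊆ (Ws n).carrier ∩ W.carrier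 ∧ Metric.ball (Literature.Probability.LatticeModels.meshPoint δ d) s ⊆ (Ws n).carrier ∩ W.carrier ∧ (Literature.Probability.LatticeModels.discreteDomainGraph (Ws n).carrier δ).Reachable x c ∧ (Literature.Probability.LatticeModels.discreteDomainGraph (Ws n).carrier δ).Reachable c d ∧ (Literature.Probability.LatticeModels.discreteDomainGraph W.carrier δ).Reachable x' c ∧ (Literature.Probability.LatticeModels.discreteDomainGraph W.carrier δ).Reachable c d)

/-- Registered stub: piece 1 (`PinLocality`, statement verbatim). [folklore] -/
theorem stub_pinLocality :
    ∀ (D : Literature.Probability.RandomPlanarGeometry.DobrushinDomain), (let IsWall : Literature.Probability.RandomPlanarGeometry.CurveClass ℂ → Literature.Probability.RandomPlanarGeometry.DobrushinDomain → Prop := fun η W => W.carrier ⊆ D.carrier ∧ W.pt 0 = D.pt 0 ∧ W.pt 1 = D.pt 1 ∧ frontier W.carrier = η.range ∪ D.arc 1; ∀ (ηs : ℕ → Literature.Probability.RandomPlanarGeometry.CurveClass ℂ) (η : Literature.Probability.RandomPlanarGeometry.CurveClass ℂ) (Ws : ℕ → Literature.Probability.RandomPlanarGeometry.DobrushinDomain)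 (W : Literature.Probability.RandomPlanarGeometry.DobrushinDomain), (∀ n, IsWall (ηs n) (Ws n)) → IsWall η W → η ∈ Literature.Probability.RandomPlanarGeometry.CurveClass.simple → Filter.Tendsto ηs Filter.atTop (nhds η) → ∀ f : BoundedContinuousFunction (Literature.Probability.RandomPlanarGeometry.CurveClass ℂ) ℝ, ∀ ε > (0 : ℝ), ∃ ρ : ℝ, 0 < ρ ∧ ∃ N : ℕ, ∃ δ₀ : ℝ, 0 < δ₀ ∧ ∀ n ≥ N, ∀ δ ∈ Set.Ioo (0 : ℝ) δ₀, ∀ x y x' y' : Literature.Probability.LatticeModels.Site 2, dist (Literature.Probability.LatticeModels.meshPoint δ x) (D.pt 0) < ρ → dist (Literature.Probability.LatticeModels.meshPoint δ y) (D.pt 1) < ρ → dist (Literature.Probability.LatticeModels.meshPoint δ x') (D.pt 0) < ρ → dist (Literature.Probability.LatticeModels.meshPoint δ y') (D.pt 1) < ρ → (Literature.Probability.LatticeModels.discreteDomainGraph (Ws n).carrier δ).Reachable x y → (Literature.Probability.LatticeModels.discreteDomainGraph (Ws n).carrier δ).Reachable x' y' → (Literature.Probability.LatticeModels.discreteDomainGraph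 (Ws n).carrier δ).Reachable x x' → |(∫ γ, f γ.curve ∂(Literature.Probability.RandomPlanarGeometry.SAW.law (Ws n).carrier δ x y)) - ∫ γ, f γ.curve ∂(Literature.Probability.RandomPlanarGeometry.SAW.law (Ws n).carrier δ x' y')| < ε) := by
  sorry

/-- Registered stub: piece 2 (`CommonPinWallContinuity`, statement verbatim). [folklore] -/
theorem stub_commonPinWallContinuity :
    ∀ (D : Literature.Probability.RandomPlanarGeometry.DobrushinDomain), (let IsWall : Literature.Probability.RandomPlanarGeometry.CurveClass ℂ → Literature.Probability.RandomPlanarGeometry.DobrushinDomain → Prop := fun η W => W.carrier ⊆ D.carrier ∧ W.pt 0 = D.pt 0 ∧ W.pt 1 = D.pt 1 ∧ frontier W.carrier = η.range ∪ D.arc 1; ∀ (ηs : ℕ → Literature.Probability.RandomPlanarGeometry.CurveClass ℂ) (η : Literature.Probability.RandomPlanarGeometry.CurveClass ℂ) (Ws : ℕ → Literature.Probability.RandomPlanarGeometry.DobrushinDomain) (W : Literature.Probability.RandomPlanarGeometry.DobrushinDomain), (∀ n, IsWall (ηs n) (Ws n)) → IsWall η W → η ∈ Literature.Probability.RandomPlanarGeometry.CurveClass.simple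 → Filter.Tendsto ηs Filter.atTop (nhds η) → ∀ f : BoundedContinuousFunction (Literature.Probability.RandomPlanarGeometry.CurveClass ℂ) ℝ, ∀ ε > (0 : ℝ), ∃ ρ : ℝ, 0 < ρ ∧ ∀ s > (0 : ℝ), ∃ N : ℕ, ∃ δ₀ : ℝ, 0 < δ₀ ∧ ∀ n ≥ N, ∀ δ ∈ Set.Ioo (0 : ℝ) δ₀, ∀ x y : Literature.Probability.LatticeModels.Site 2, dist (Literature.Probability.LatticeModels.meshPoint δ x) (D.pt 0) < ρ → dist (Literature.Probability.LatticeModels.meshPoint δ y) (D.pt 1) < ρ → Metric.ball (Literature.Probability.LatticeModels.meshPoint δ x) s ⊆ (Ws n).carrier ∩ W.carrier → Metric.ball (Literature.Probability.LatticeModels.meshPoint δ y) s ⊆ (Ws n).carrier ∩ W.carrier → (Literature.Probability.LatticeModels.discreteDomainGraph (Ws n).carrier δ).Reachable x y → (Literature.Probability.LatticeModels.discreteDomainGraph W.carrier δ).Reachable x y → |(∫ γ, f γ.curve ∂(Literature.Probability.RandomPlanarGeometry.SAW.law (Ws n).carrier δ x y)) - ∫ γ, f γ.curve ∂(Literature.Probability.RandomPlanarGeometry.SAW.law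 W.carrier δ x y)| < ε) := by
  sorry

/-- Registered stub: piece 3 (`CommonPinsExist`, statement verbatim). [folklore] -/
theorem stub_commonPinsExist :
    ∀ (D : Literature.Probability.RandomPlanarGeometry.DobrushinDomain), (let IsWall : Literature.Probability.RandomPlanarGeometry.CurveClass ℂ → Literature.Probability.RandomPlanarGeometry.DobrushinDomain → Prop := fun η W => W.carrier ⊆ D.carrier ∧ W.pt 0 = D.pt 0 ∧ W.pt 1 = D.pt 1 ∧ frontier W.carrier = η.range ∪ D.arc 1; ∀ (ηs : ℕ → Literature.Probability.RandomPlanarGeometry.CurveClass ℂ) (η : Literature.Probability.RandomPlanarGeometry.CurveClass ℂ) (Ws : ℕ → Literature.Probability.RandomPlanarGeometry.DobrushinDomain) (W : Literature.Probability.RandomPlanarGeometry.DobrushinDomain), (∀ n, IsWall (ηs n) (Ws n)) → IsWall η W → η ∈ Literature.Probability.RandomPlanarGeometry.CurveClass.simple → Filter.Tendsto ηs Filter.atTop (nhds η) → ∀ ρ > (0 : ℝ), ∃ ρ' : ℝ, 0 < ρ' ∧ ∃ s : ℝ, 0 < s ∧ ∃ N : ℕ, ∃ δ₀ : ℝ,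 0 < δ₀ ∧ ∀ n ≥ N, ∀ δ ∈ Set.Ioo (0 : ℝ) δ₀, ∀ x y x' y' : Literature.Probability.LatticeModels.Site 2, dist (Literature.Probability.LatticeModels.meshPoint δ x) (D.pt 0) < ρ' → dist (Literature.Probability.LatticeModels.meshPoint δ y) (D.pt 1) < ρ' → dist (Literature.Probability.LatticeModels.meshPoint δ x') (D.pt 0) < ρ' → dist (Literature.Probability.LatticeModels.meshPoint δ y') (D.pt 1) < ρ' → (Literature.Probability.LatticeModels.discreteDomainGraph (Ws n).carrier δ).Reachable x y → (Literature.Probability.LatticeModels.discreteDomainGraph W.carrier δ).Reachable x' y' → ∃ c d : Literature.Probability.LatticeModels.Site 2, dist (Literature.Probability.LatticeModels.meshPoint δ c) (D.pt 0) < ρ ∧ dist (Literature.Probability.LatticeModels.meshPoint δ d) (D.pt 1) < ρ ∧ Metric.ball (Literature.Probability.LatticeModels.meshPoint δ c) s ⊆ (Ws n).carrier ∩ W.carrier ∧ Metric.ball (Literature.Probability.LatticeModels.meshPoint δ d) s ⊆ (Ws n).carrier ∩ W.carrier ∧ (Literature.Probability.LatticeModels.discreteDomainGraph (Ws n).carrier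 δ).Reachable x c ∧ (Literature.Probability.LatticeModels.discreteDomainGraph (Ws n).carrier δ).Reachable c d ∧ (Literature.Probability.LatticeModels.discreteDomainGraph W.carrier δ).Reachable x' c ∧ (Literature.Probability.LatticeModels.discreteDomainGraph W.carrier δ).Reachable c d) := by
  sorry

/-! ## Name-keyed aliases of the three piece statements — the hypotheses of `DomainContinuity_of`

The native skeleton audit (`#h21_check_skeleton`, run by `ledger skeleton check`) admits a hypothesis of the
composing theorem only if its head constant is a registered obligation or is NAMED like a declared stub;
`__Registered.stub_X` is the piece `X` under the stub's short name (device of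
`AnomalousDissipation/…/Cruxes/CyclicWindLineLoud/Lines/birth.lean`). Each alias is an `abbrev` of the piece
`def`, so `DomainContinuity_of h₁ h₂ h₃` also typechecks for `h₁ : PinLocality`, `h₂ : CommonPinWallContinuity`,
`h₃ : CommonPinsExist` (definitional unfolding), and — once the route is split — for the route's child decls,
whose texts are these verbatim. -/
namespace __Registered

/-- Alias of piece 1, keyed by the stub name. -/
abbrev stub_pinLocality : Prop := PinLocality

/-- Alias of piece 2, keyed by the stub name. -/
abbrev stub_commonPinWallContinuity : Prop := CommonPinWallContinuity

/-- Alias of piece 3, keyed by the stub name. -/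
abbrev stub_commonPinsExist : Prop := CommonPinsExist

end __Registered

/-- The assembly (kernel-checked, no sorry): the three pieces give the crux BY NAME. An
`ε/3`-argument through a common anchor pair `(c, d)`: `PinLocality` in `Ws n` (given pins ↦
anchors), `CommonPinWallContinuity` at the anchors (`Ws n` ↦ `W`), `PinLocality` for the constant
wall sequence `W` (anchors ↦ `(a δ, b δ)`); the anchors come from `CommonPinsExist`, triggered by
the two reachability hypotheses of the crux once all pins are within the trigger radius, which the
mesh threshold enforces (eventual closeness extracted from `𝓝[>] 0`). [folklore] -/
theorem DomainContinuity_of :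
    __Registered.stub_pinLocality → __Registered.stub_commonPinWallContinuity →
      __Registered.stub_commonPinsExist → DomainContinuity := by
  intro hP hQ hG D
  dsimp only
  intro ηs η Ws W av bv a b hWs hW hη hconv hab hpins f ε hε
  have hε3 : (0 : ℝ) < ε / 3 := by positivity
  -- piece 1 along the given wall sequence
  have hP1 := hP D
  dsimp only at hP1
  obtain ⟨ρ₁, hρ₁, N₁, δ₁, hδ₁, H₁⟩ := hP1 ηs η Ws W hWs hW hη hconv f (ε / 3) hε3
  -- piece 1 along the constant wall sequence `W`
  have hP2 := hP D
  dsimp only at hP2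
  obtain ⟨ρ₂, hρ₂, N₂, δ₂, hδ₂, H₂⟩ :=
    hP2 (fun _ => η) η (fun _ => W) W (fun _ => hW) hW hη tendsto_const_nhds f (ε / 3) hε3
  -- piece 2
  have hQ1 := hQ D
  dsimp only at hQ1
  obtain ⟨ρ₃, hρ₃, H₃'⟩ := hQ1 ηs η Ws W hWs hW hη hconv f (ε / 3) hε3
  -- a common radius for the anchors
  obtain ⟨ρ, hρ, hρle₁, hρle₂, hρle₃⟩ : ∃ ρ : ℝ, 0 < ρ ∧ ρ ≤ ρ₁ ∧ ρ ≤ ρ₂ ∧ ρ ≤ ρ₃ :=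
    ⟨min ρ₁ (min ρ₂ ρ₃), lt_min hρ₁ (lt_min hρ₂ hρ₃), min_le_left _ _,
      (min_le_right _ _).trans (min_le_left _ _), (min_le_right _ _).trans (min_le_right _ _)⟩
  -- piece 3 at radius ρ
  have hG1 := hG D
  dsimp only at hG1
  obtain ⟨ρ', hρ', s, hs, N₄, δ₄, hδ₄, H₄⟩ := hG1 ηs η Ws W hWs hW hη hconv ρ hρ
  -- piece 2 at the depth `s` of the anchors
  obtain ⟨N₃, δ₃, hδ₃, H₃⟩ := H₃' s hs
  -- the radius within which all the pins of the crux must lie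
  obtain ⟨σ, hσ, hσle', hσle₁, hσle₂⟩ : ∃ σ : ℝ, 0 < σ ∧ σ ≤ ρ' ∧ σ ≤ ρ₁ ∧ σ ≤ ρ₂ :=
    ⟨min ρ' (min ρ₁ ρ₂), lt_min hρ' (lt_min hρ₁ hρ₂), min_le_left _ _,
      (min_le_right _ _).trans (min_le_left _ _), (min_le_right _ _).trans (min_le_right _ _)⟩
  -- eventually in δ, every pin is within σ of its mark
  have hW0 : W.pt 0 = D.pt 0 := hW.2.1
  have hW1 : W.pt 1 = D.pt 1 := hW.2.2.1
  have ha' : ∀ᶠ δ in nhdsWithin (0 : ℝ) (Set.Ioi 0),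
      dist (Literature.Probability.LatticeModels.meshPoint δ (a δ)) (D.pt 0) < σ := by
    have h := Metric.tendsto_nhds.1 hab.tendsto_fst σ hσ
    rw [hW0] at h
    exact h
  have hb' : ∀ᶠ δ in nhdsWithin (0 : ℝ) (Set.Ioi 0),
      dist (Literature.Probability.LatticeModels.meshPoint δ (b δ)) (D.pt 1) < σ := by
    have h := Metric.tendsto_nhds.1 hab.tendsto_snd σ hσ
    rw [hW1] at h
    exact h
  have hev := (hpins σ hσ).and (ha'.and hb')
  obtain ⟨u, hu, hsub⟩ := mem_nhdsGT_iff_exists_Ioo_subset.1 hev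
  have hu0 : (0 : ℝ) < u := hu
  -- the thresholds
  refine ⟨max N₁ (max N₂ (max N₃ N₄)), min δ₁ (min δ₂ (min δ₃ (min δ₄ u))),
    lt_min hδ₁ (lt_min hδ₂ (lt_min hδ₃ (lt_min hδ₄ hu0))), ?_⟩
  intro n hn δ hδ hRn hRW
  simp only [ge_iff_le, max_le_iff] at hn
  obtain ⟨hn₁, hn₂, hn₃, hn₄⟩ := hn
  obtain ⟨hδ0, hδ'⟩ := hδ
  simp only [lt_min_iff] at hδ'
  obtain ⟨hδ₁', hδ₂', hδ₃', hδ₄', hδu⟩ := hδ'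
  have hp : (∀ n, dist (Literature.Probability.LatticeModels.meshPoint δ (av n δ)) (D.pt 0) < σ ∧
      dist (Literature.Probability.LatticeModels.meshPoint δ (bv n δ)) (D.pt 1) < σ) ∧
      dist (Literature.Probability.LatticeModels.meshPoint δ (a δ)) (D.pt 0) < σ ∧
      dist (Literature.Probability.LatticeModels.meshPoint δ (b δ)) (D.pt 1) < σ :=
    hsub ⟨hδ0, hδu⟩
  obtain ⟨hpn, hpa, hpb⟩ := hp
  obtain ⟨hav, hbv⟩ := hpn n
  -- the common anchors
  obtain ⟨c, d, hc, hd, hcs, hds, hRxc, hRc, hRxc', hRc'⟩ := H₄ n hn₄ δ ⟨hδ0, hδ₄'⟩ (av n δ) (bv n δ) (a δ) (b δ)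
    (hav.trans_le hσle') (hbv.trans_le hσle') (hpa.trans_le hσle') (hpb.trans_le hσle') hRn hRW
  -- three ε/3 estimates
  have e1 : |(∫ γ, f γ.curve ∂(Literature.Probability.RandomPlanarGeometry.SAW.law (Ws n).carrier δ (av n δ) (bv n δ))) -
      ∫ γ, f γ.curve ∂(Literature.Probability.RandomPlanarGeometry.SAW.law (Ws n).carrier δ c d)| < ε / 3 :=
    H₁ n hn₁ δ ⟨hδ0, hδ₁'⟩ (av n δ) (bv n δ) c d (hav.trans_le hσle₁) (hbv.trans_le hσle₁)
      (hc.trans_le hρle₁) (hd.trans_le hρle₁) hRn hRc hRxc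
  have e2 : |(∫ γ, f γ.curve ∂(Literature.Probability.RandomPlanarGeometry.SAW.law (Ws n).carrier δ c d)) -
      ∫ γ, f γ.curve ∂(Literature.Probability.RandomPlanarGeometry.SAW.law W.carrier δ c d)| < ε / 3 :=
    H₃ n hn₃ δ ⟨hδ0, hδ₃'⟩ c d (hc.trans_le hρle₃) (hd.trans_le hρle₃) hcs hds hRc hRc'
  have e3 : |(∫ γ, f γ.curve ∂(Literature.Probability.RandomPlanarGeometry.SAW.law W.carrier δ c d)) -
      ∫ γ, f γ.curve ∂(Literature.Probability.RandomPlanarGeometry.SAW.law W.carrier δ (a δ) (b δ))| < ε / 3 :=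
    H₂ n hn₂ δ ⟨hδ0, hδ₂'⟩ c d (a δ) (b δ) (hc.trans_le hρle₂) (hd.trans_le hρle₂)
      (hpa.trans_le hσle₂) (hpb.trans_le hσle₂) hRc' hRW hRxc'.symm
  -- triangle inequality
  have key : ∀ A B C E : ℝ, |A - B| < ε / 3 → |B - C| < ε / 3 → |C - E| < ε / 3 → |A - E| < ε := by
    intro A B C E h1 h2 h3
    have h : |A - E| ≤ |A - B| + |B - C| + |C - E| := by
      have := abs_add_three (A - B) (B - C) (C - E)
      rwa [show A - B + (B - C) + (C - E) = A - E by ring] at this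
    linarith
  exact key _ _ _ _ e1 e2 e3

/-- WIRING CHECK: the three sorried stubs compose to a closed term of the crux's type (modulo their
`sorry`s). An `example`, so that no pre-composed witness of the crux enters the environment. -/
example : DomainContinuity :=
  DomainContinuity_of stub_pinLocality stub_commonPinWallContinuity stub_commonPinsExist

/-- Readable form of the assembly over the piece names (definitionally the same theorem). -/
example : PinLocality → CommonPinWallContinuity → CommonPinsExist → DomainContinuity :=
  fun hP hQ hG => DomainContinuity_of hP hQ hG

end Summit.CriticalPhenomena.SAWScalingLimit.Cruxes.DomainContinuity.CommonPinTriangle
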